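import Literature.Topology.FourManifolds.ProjectiveLineRotationField
import HarnessLib

/-!
# The two affine parametrisations of `ℂℙ¹` and the product charts of `ℂℙ¹ × ℂ`

Topic `Literature/Geometry/Symplectic`; manifold plumbing on the tree's Riemann sphere
`ℂℙ¹ = ComplexProjectiveSpace 1` (`Literature/Topology/FourManifolds/ComplexProjectiveSpace.lean`,
charted on the literal model `EuclideanSpace ℝ (Fin 2)` by
`ComplexProjectiveSpace.instChartedSpaceOne`, a `C^∞` manifold at `𝓡 2` by
`Literature.Geometry.Kaehler.CPn.instIsManifoldOne`), for implicit-function-theorem constructions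
of `J`-holomorphic spheres near an embedded one (C. Wendl, *Holomorphic Curves in Low Dimensions*
(2018), Thm. 2.46, Prop. 2.53), where maps `S² → X` near an embedded sphere with trivial normal
bundle are written in a product neighbourhood `ι : ℂℙ¹ × ℂ ↪ X` and in the two affine charts of
`ℂℙ¹`.

## The affine parametrisations (existing vocabulary, completed here)

The tree's affine parametrisations are
`Literature.Topology.FourManifolds.CodimTwoData.linePt i : ℂ → ℂℙ¹` (`i : Fin 2`;
`ProjectiveLineRotationField.lean`): `linePt i z = (affineChart i)⁻¹ (z)`, i.e.
`linePt 0 z = [1 : z]` and `linePt 1 w = [w : 1]` (`linePt_eq_mk_homogenize`; they are the points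
`linePt₀ z`, `linePt₁ w` of `ComplexProjectiveLineClutching.lean`, `linePt_zero_eq_linePt₀`,
`linePt_one_eq_linePt₁`). Already in the tree: `CodimTwoData.continuous_linePt`,
`contMDiff_linePt` (`C^∞` into `(ℂℙ¹, 𝓡 2)`), `affineCoordComplex_linePt`
(`affineCoordComplex i (linePt i z) 0 = z`), `coordNeZero_linePt`, `linePt_affineCoordComplex`
(`linePt i (affineCoordComplex i p 0) = p` on `{pᵢ ≠ 0}`), `linePt_one_inv`
(`linePt 1 z⁻¹ = linePt 0 z`), `eq_linePt_one_zero`, `not_coordNeZero_zero_linePt_one_zero`, and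
the overlap relation `ComplexProjectiveSpace.affineCoordComplex_one_eq_inv`
(`affineCoordComplex 1 p 0 = (affineCoordComplex 0 p 0)⁻¹`, `ComplexProjectiveSpacePositiveAtlas.lean`).
This file adds: `linePt_injective`, `range_linePt` (`= {pᵢ ≠ 0}`), `isOpenMap_linePt`,
`isOpenEmbedding_linePt`, `contMDiff_linePt_omega` / `contMDiff_linePt'` (analytic, hence `C^m`
for every `m`), `injective_mfderiv_linePt` (**`linePt i` is an immersion**: it has the `C^∞` left
inverse `p ↦ affineCoordComplex i p 0` on the open chart domain,
`mfderiv_affineCoordComplex_comp_mfderiv_linePt`),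
`linePt_one_eq_linePt_zero_inv` / `linePt_zero_eq_linePt_one_inv` (**the overlap is the
inversion** `w = 1/z`), `affineCoordComplex_one_linePt_zero`, `affineCoordComplex_zero_linePt_one`,
`coordNeZero_one_linePt_zero_iff`, `coordNeZero_zero_linePt_one_iff`,
`eq_linePt_zero_or_eq_linePt_one_zero` (every point is `[1 : z]` or `∞ = [0 : 1]`),
`exists_linePt_eq`, and the compatibility with the two-chart-sphere convention of
`JPlanePencilMemberSphere.lean` / `PencilEndMemberGlued.lean`: a map `F : ℂℙ¹ → X` with
`F p = u (affineCoordComplex 0 p 0)` on `{p₀ ≠ 0}` and `F p = v (affineCoordComplex 1 p 0)` on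
`{p₁ ≠ 0}` satisfies `F (linePt 0 z) = u z`, `F (linePt 1 w) = v w` (`apply_linePt_eq`).

## The product charts

For `ι : ℂℙ¹ × ℂ → X` (typically the product-neighbourhood embedding of an embedded sphere with
trivial normal bundle) the **product charts** are
`prodChart i ι : ℂ × ℂ → X`, `prodChart i ι (z, t) = ι (linePt i z, t)` (the one definition of
this file). We prove: `prodChart_one_eq` (`prodChart 1 ι (w, t) = prodChart 0 ι (w⁻¹, t)` for
`w ≠ 0`) and its `∀ᶠ` form, `prodChart_apply_zero_eq` / `prodChart_zero_zero_eq` /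
`prodChart_one_zero_eq` (along `t = 0` the charts are the two charts `u₀`, `v₀` of the central
sphere when `ι (θ, 0) = F₀ θ`), `continuous_prodChart`, `contMDiff_prodChart`
(`C^∞` from `(ℂ × ℂ, 𝓘(ℝ, ℂ × ℂ))` when `ι` is `C^∞` from `(ℂℙ¹ × ℂ, (𝓡 2).prod 𝓘(ℝ, ℂ))`),
`hasMFDerivAt_prodChart` (chain rule through `hasMFDerivAt_linePt_prod`) and
`injective_mfderiv_prodChart` (**an immersion when `ι` is**), `prodChart_injective`,
`isOpenEmbedding_prodChart`, `range_prodChart`; the derivative along a slice `t = const`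
(`hasMFDerivAt_prodChart_slice`, `mfderiv_prodChart_comp_inl`: `du₀ = d(prodChart 0 ι) ∘ inl`
along the central sphere); the chart change `Ψ (w, t) = (w⁻¹, t)` with its real differential
`(a, b) ↦ (-w⁻² a, b)` (`hasFDerivAt_invFst`, `fderiv_invFst_apply`) and the chain rule across it
(`hasMFDerivAt_prodChart_one_of_ne`, `mfderiv_prodChart_one_apply_of_ne`); and the dimension
bookkeeping `finrank_real_complex_prod_eq : finrank ℝ (ℂ × ℂ) = 4` (companion of
`Literature.Geometry.Symplectic.finrank_complex_prod` in `JSphereFamilyLeafFunction.lean`).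

## References

* P. Griffiths, J. Harris, *Principles of Algebraic Geometry* (1978), Ch. 0 §2 (the affine charts
  of `ℂℙⁿ`, `ℂℙ¹` as the Riemann sphere). [GriffithsHarrisPrinciples1978]
* C. Wendl, *Holomorphic Curves in Low Dimensions*, LNM 2216 (2018), Thm. 2.46, Prop. 2.53.
  [Wendl2018]

Design: no new parametrisation of `ℂℙ¹` is introduced (the tree's `CodimTwoData.linePt` is
reused); all smoothness statements are at the literal models `𝓡 2`, `𝓡 4`, `𝓘(ℝ, ℂ)`,
`𝓘(ℝ, ℂ × ℂ)` used by the summit statements. Not here: the almost complex structure read through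
`prodChart` (`AlmostComplexThroughImmersion.lean`) and any analysis.
-/

noncomputable section

open scoped Manifold ContDiff Topology
open Set Function Filter
open Literature.Topology.FourManifolds Literature.Topology.FourManifolds.ComplexProjectiveSpace
open Literature.Topology.FourManifolds.CodimTwoData (linePt continuous_linePt contMDiff_linePt
  affineCoordComplex_linePt coordNeZero_linePt linePt_affineCoordComplex linePt_one_inv
  eq_linePt_one_zero not_coordNeZero_zero_linePt_one_zero)

namespace Literature.Geometry.Symplectic

/-! ### The affine parametrisations `linePt i : ℂ → ℂℙ¹` -/

section LinePt

/-- `linePt i z` is the class of the homogenised vector: `linePt 0 z = [1 : z]`,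
`linePt 1 w = [w : 1]`. [cite: GriffithsHarrisPrinciples1978, Ch. 0 §2] -/
theorem linePt_eq_mk_homogenize (i : Fin 2) (z : ℂ) :
    linePt i z = mk (homogenize i fun _ : Fin 1 => z) := by
  rw [CodimTwoData.linePt, affineChart_symm_apply, ContinuousLinearEquiv.symm_apply_apply]

/-- `linePt 0 z` is the point `linePt₀ z = [1 : z]` of `ComplexProjectiveLineClutching.lean`.
[folklore] -/
theorem linePt_zero_eq_linePt₀ (z : ℂ) : linePt 0 z = linePt₀ z := by
  rw [linePt_eq_mk_homogenize, linePt₀]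
  congr 1
  ext j
  fin_cases j <;> simp [homogenize]

/-- `linePt 1 w` is the point `linePt₁ w = [w : 1]` of `ComplexProjectiveLineClutching.lean`.
[folklore] -/
theorem linePt_one_eq_linePt₁ (w : ℂ) : linePt 1 w = linePt₁ w := by
  rw [linePt_eq_mk_homogenize, linePt₁]
  congr 1
  ext j
  fin_cases j <;> simp [homogenize, Fin.insertNth_apply_below]

/-- `linePt i` is injective (it has the left inverse `p ↦ affineCoordComplex i p 0`).
[cite: GriffithsHarrisPrinciples1978, Ch. 0 §2] -/
theorem linePt_injective (i : Fin 2) : Injective (linePt i) :=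
  HasLeftInverse.injective ⟨fun p => affineCoordComplex i p 0, affineCoordComplex_linePt i⟩

/-- The image of `linePt i` is the affine chart domain `{pᵢ ≠ 0}`.
[cite: GriffithsHarrisPrinciples1978, Ch. 0 §2] -/
theorem range_linePt (i : Fin 2) : range (linePt i) = {p | CoordNeZero i p} := by
  ext p
  exact ⟨by rintro ⟨z, rfl⟩; exact coordNeZero_linePt i z,
    fun hp => ⟨_, linePt_affineCoordComplex hp⟩⟩

/-- The image of `linePt i` is open. [folklore] -/
theorem isOpen_range_linePt (i : Fin 2) : IsOpen (range (linePt i)) := by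
  rw [range_linePt]
  exact isOpen_setOf_coordNeZero i

/-- `linePt i` factors as the inverse affine chart after the linear homeomorphism
`z ↦ realCoordinates 1 (fun _ => z)` of `ℂ` onto the model plane. [folklore] -/
theorem linePt_eq_comp (i : Fin 2) :
    linePt i = (affineChart (n := 1) i).symm ∘
      ((ContinuousLinearEquiv.funUnique (Fin 1) ℝ ℂ).symm.trans (realCoordinates 1)) := by
  funext z
  rfl

/-- `linePt i` is an open map (inverse chart after a homeomorphism). [folklore] -/
theorem isOpenMap_linePt (i : Fin 2) : IsOpenMap (linePt i) := by
  rw [linePt_eq_comp]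
  refine IsOpenMap.comp (fun U hU => ?_) (ContinuousLinearEquiv.isOpenMap _)
  exact (affineChart (n := 1) i).isOpen_image_symm_of_subset_target hU
    (by rw [affineChart_target]; exact subset_univ _)

/-- **`linePt i : ℂ → ℂℙ¹` is an open embedding** onto the chart domain `{pᵢ ≠ 0}`.
[cite: GriffithsHarrisPrinciples1978, Ch. 0 §2] -/
theorem isOpenEmbedding_linePt (i : Fin 2) : Topology.IsOpenEmbedding (linePt i) :=
  .of_continuous_injective_isOpenMap (continuous_linePt i) (linePt_injective i) (isOpenMap_linePt i)

/-- **The overlap is the inversion**: `[z : 1] = [1 : z⁻¹]` for `z ≠ 0`.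
[cite: GriffithsHarrisPrinciples1978, Ch. 0 §2] -/
theorem linePt_one_eq_linePt_zero_inv {z : ℂ} (hz : z ≠ 0) : linePt 1 z = linePt 0 z⁻¹ := by
  rw [← linePt_one_inv (inv_ne_zero hz), inv_inv]

/-- **The overlap is the inversion**: `[1 : z] = [z⁻¹ : 1]` for `z ≠ 0`.
[cite: GriffithsHarrisPrinciples1978, Ch. 0 §2] -/
theorem linePt_zero_eq_linePt_one_inv {z : ℂ} (hz : z ≠ 0) : linePt 0 z = linePt 1 z⁻¹ :=
  (linePt_one_inv hz).symm

/-- The second affine coordinate of `[1 : z]` is `z⁻¹` (junk value `0⁻¹ = 0` at `z = 0`).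
[cite: GriffithsHarrisPrinciples1978, Ch. 0 §2] -/
theorem affineCoordComplex_one_linePt_zero (z : ℂ) :
    affineCoordComplex 1 (linePt 0 z) 0 = z⁻¹ := by
  rw [affineCoordComplex_one_eq_inv, affineCoordComplex_linePt]

/-- The first affine coordinate of `[w : 1]` is `w⁻¹` (junk value `0⁻¹ = 0` at `w = 0`).
[cite: GriffithsHarrisPrinciples1978, Ch. 0 §2] -/
theorem affineCoordComplex_zero_linePt_one (w : ℂ) :
    affineCoordComplex 0 (linePt 1 w) 0 = w⁻¹ := by
  rw [← inv_inv (affineCoordComplex 0 (linePt 1 w) 0), ← affineCoordComplex_one_eq_inv,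
    affineCoordComplex_linePt]

/-- `[1 : z]` lies in the chart `{p₁ ≠ 0}` iff `z ≠ 0`. [folklore] -/
theorem coordNeZero_one_linePt_zero_iff {z : ℂ} : CoordNeZero 1 (linePt 0 z) ↔ z ≠ 0 := by
  rw [linePt_eq_mk_homogenize, coordNeZero_mk]
  simp [homogenize]

/-- `[w : 1]` lies in the chart `{p₀ ≠ 0}` iff `w ≠ 0`. [folklore] -/
theorem coordNeZero_zero_linePt_one_iff {w : ℂ} : CoordNeZero 0 (linePt 1 w) ↔ w ≠ 0 := by
  rw [linePt_eq_mk_homogenize, coordNeZero_mk]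
  simp [homogenize, Fin.insertNth_apply_below]

/-- `linePt i z` lies in the other chart iff `z ≠ 0`. [folklore] -/
theorem coordNeZero_linePt_iff_of_ne {i j : Fin 2} (hij : j ≠ i) {z : ℂ} :
    CoordNeZero j (linePt i z) ↔ z ≠ 0 := by
  fin_cases i <;> fin_cases j
  · exact absurd rfl hij
  · exact coordNeZero_one_linePt_zero_iff
  · exact coordNeZero_zero_linePt_one_iff
  · exact absurd rfl hij

/-- **Every point of `ℂℙ¹` is `[1 : z]` for some `z`, or the point at infinity `[0 : 1]`.**
[cite: GriffithsHarrisPrinciples1978, Ch. 0 §2] -/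
theorem eq_linePt_zero_or_eq_linePt_one_zero (p : ComplexProjectiveSpace 1) :
    (∃ z : ℂ, p = linePt 0 z) ∨ p = linePt 1 0 := by
  by_cases h : CoordNeZero 0 p
  · exact Or.inl ⟨_, (linePt_affineCoordComplex h).symm⟩
  · exact Or.inr (eq_linePt_one_zero h)

/-- Every point of `ℂℙ¹` is `linePt i z` for some chart `i` and some `z`. [folklore] -/
theorem exists_linePt_eq (p : ComplexProjectiveSpace 1) : ∃ (i : Fin 2) (z : ℂ), linePt i z = p := by
  obtain ⟨i, hi⟩ := exists_coordNeZero p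
  exact ⟨i, _, linePt_affineCoordComplex hi⟩

/-- The two parametrisations cover `ℂℙ¹`. [folklore] -/
theorem range_linePt_zero_union_range_linePt_one :
    range (linePt 0) ∪ range (linePt 1) = univ := by
  refine eq_univ_of_forall fun p => ?_
  rcases eq_linePt_zero_or_eq_linePt_one_zero p with ⟨z, rfl⟩ | rfl
  · exact Or.inl ⟨z, rfl⟩
  · exact Or.inr ⟨0, rfl⟩

/-- **Compatibility with the two-chart-sphere convention.** A map `F : ℂℙ¹ → X` which is
`uv i ∘ (p ↦ affineCoordComplex i p 0)` on the chart domain `{pᵢ ≠ 0}` takes the value `uv i z`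
at `linePt i z`. [folklore] -/
theorem apply_linePt_eq {X : Type*} {F : ComplexProjectiveSpace 1 → X} {i : Fin 2} {w : ℂ → X}
    (hF : ∀ p, CoordNeZero i p → F p = w (affineCoordComplex i p 0)) (z : ℂ) :
    F (linePt i z) = w z := by
  rw [hF _ (coordNeZero_linePt i z), affineCoordComplex_linePt]

/-! ### `linePt i` is an immersion -/

/-- `linePt i` is real-analytic into `(ℂℙ¹, 𝓡 2)` (inverse of an analytic atlas member after a
linear map; `ℂℙ¹` is an analytic manifold, `ComplexProjectiveSpace.instIsManifold`). [folklore] -/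
theorem contMDiff_linePt_omega (i : Fin 2) : ContMDiff 𝓘(ℝ, ℂ) (𝓡 2) ω (linePt i) := by
  have h1 : ContMDiffOn (𝓡 (2 * 1)) (𝓡 (2 * 1)) ω (affineChart (n := 1) i).symm
      (affineChart (n := 1) i).target :=
    contMDiffOn_symm_of_mem_maximalAtlas
      (IsManifold.subset_maximalAtlas ((mem_atlas_iff _).2 ⟨i, rfl⟩))
  have h2 : ContMDiff 𝓘(ℝ, ℂ) 𝓘(ℝ, EuclideanSpace ℝ (Fin (2 * 1))) ω
      (fun z : ℂ => realCoordinates 1 (fun _ : Fin 1 => z)) :=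
    ((realCoordinates 1).contDiff.comp (contDiff_pi.2 fun _ => contDiff_id)).contMDiff
  have h : ContMDiff 𝓘(ℝ, ℂ) (𝓡 (2 * 1)) ω (linePt i) := (contMDiffOn_univ.1 h1).comp h2
  exact h

/-- `linePt i` is `C^m` into `(ℂℙ¹, 𝓡 2)` for every `m ≤ ω` (for `m = ∞` this is the tree's
`CodimTwoData.contMDiff_linePt`). [folklore] -/
theorem contMDiff_linePt' (i : Fin 2) {m : WithTop ℕ∞} : ContMDiff 𝓘(ℝ, ℂ) (𝓡 2) m (linePt i) :=
  (contMDiff_linePt_omega i).of_le le_top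

/-- `linePt i` is differentiable. [folklore] -/
theorem mdifferentiable_linePt (i : Fin 2) : MDifferentiable 𝓘(ℝ, ℂ) (𝓡 2) (linePt i) :=
  (contMDiff_linePt i).mdifferentiable (by simp)

/-- **Chain rule for the left inverse**: on `ℂ`, `(p ↦ affineCoordComplex i p 0) ∘ linePt i = id`,
so `d(affineCoordComplex i · 0) ∘ d(linePt i)_z = id`. [folklore] -/
theorem mfderiv_affineCoordComplex_comp_mfderiv_linePt (i : Fin 2) (z : ℂ) :
    (mfderiv (𝓡 2) 𝓘(ℝ, ℂ) (fun p : ComplexProjectiveSpace 1 => affineCoordComplex i p 0)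
        (linePt i z)).comp (mfderiv 𝓘(ℝ, ℂ) (𝓡 2) (linePt i) z) =
      ContinuousLinearMap.id ℝ ℂ := by
  have key : (mfderiv (𝓡 (2 * 1)) 𝓘(ℝ, ℂ)
      (fun p : ComplexProjectiveSpace 1 => affineCoordComplex i p 0) (linePt i z)).comp
        (mfderiv 𝓘(ℝ, ℂ) (𝓡 (2 * 1)) (linePt i) z) = ContinuousLinearMap.id ℝ ℂ := by
    have hc : MDifferentiableAt (𝓡 (2 * 1)) 𝓘(ℝ, ℂ)
        (fun p : ComplexProjectiveSpace 1 => affineCoordComplex i p 0) (linePt i z) :=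
      ((contMDiffOn_affineCoordComplex i).contMDiffAt
        ((isOpen_setOf_coordNeZero i).mem_nhds (coordNeZero_linePt i z))).mdifferentiableAt
          (by simp)
    have hl : MDifferentiableAt 𝓘(ℝ, ℂ) (𝓡 (2 * 1)) (linePt i) z := mdifferentiable_linePt i z
    have hcomp := hc.hasMFDerivAt.comp z hl.hasMFDerivAt
    have hid : ((fun p : ComplexProjectiveSpace 1 => affineCoordComplex i p 0) ∘ linePt i) = id :=
      funext (affineCoordComplex_linePt i)
    rw [hid] at hcomp
    rw [← hcomp.mfderiv, mfderiv_id]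
    rfl
  exact key

/-- **`linePt i : ℂ → ℂℙ¹` is an immersion**: its differential is injective at every point.
[cite: GriffithsHarrisPrinciples1978, Ch. 0 §2] -/
theorem injective_mfderiv_linePt (i : Fin 2) (z : ℂ) :
    Injective (mfderiv 𝓘(ℝ, ℂ) (𝓡 2) (linePt i) z) := by
  refine LeftInverse.injective
    (g := mfderiv (𝓡 2) 𝓘(ℝ, ℂ) (fun p : ComplexProjectiveSpace 1 => affineCoordComplex i p 0)
      (linePt i z)) fun v => ?_
  have h := DFunLike.congr_fun (mfderiv_affineCoordComplex_comp_mfderiv_linePt i z) v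
  exact h

end LinePt

/-! ### Dimension bookkeeping -/

/-- `dim_ℝ (ℂ × ℂ) = 4` (companion of `finrank_complex_prod`, which compares with
`EuclideanSpace ℝ (Fin 4)`). [folklore] -/
theorem finrank_real_complex_prod_eq : Module.finrank ℝ (ℂ × ℂ) = 4 := by
  rw [Module.finrank_prod, Complex.finrank_real_complex]

/-! ### The chart change `Ψ (w, t) = (w⁻¹, t)` of `ℂ × ℂ` -/

section ChartChange

/-- **The real differential of the chart change `Ψ (w, t) = (w⁻¹, t)`** at a point with `w ≠ 0`:
`(a, b) ↦ (-w⁻² a, b)`. [folklore] -/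
theorem hasFDerivAt_invFst {q : ℂ × ℂ} (hq : q.1 ≠ 0) :
    HasFDerivAt (fun q : ℂ × ℂ => (q.1⁻¹, q.2))
      ((((ContinuousLinearMap.smulRight (1 : ℂ →L[ℂ] ℂ) (-(q.1 ^ 2)⁻¹)).restrictScalars ℝ).comp
        (ContinuousLinearMap.fst ℝ ℂ ℂ)).prod (ContinuousLinearMap.snd ℝ ℂ ℂ)) q :=
  (((hasFDerivAt_inv hq).restrictScalars ℝ).comp q hasFDerivAt_fst).prodMk hasFDerivAt_snd

/-- The chart change `Ψ (w, t) = (w⁻¹, t)` is differentiable off `{w = 0}`. [folklore] -/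
theorem differentiableAt_invFst {q : ℂ × ℂ} (hq : q.1 ≠ 0) :
    DifferentiableAt ℝ (fun q : ℂ × ℂ => (q.1⁻¹, q.2)) q :=
  (hasFDerivAt_invFst hq).differentiableAt

/-- Values of the differential of the chart change: `dΨ_{(w, t)} (a, b) = (-w⁻² a, b)`. [folklore] -/
theorem fderiv_invFst_apply {q : ℂ × ℂ} (hq : q.1 ≠ 0) (v : ℂ × ℂ) :
    fderiv ℝ (fun q : ℂ × ℂ => (q.1⁻¹, q.2)) q v = (-(q.1 ^ 2)⁻¹ * v.1, v.2) := by
  rw [(hasFDerivAt_invFst hq).fderiv]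
  change (v.1 • (-(q.1 ^ 2)⁻¹), v.2) = _
  rw [smul_eq_mul, mul_comm]

end ChartChange

/-! ### The product charts `prodChart i ι : ℂ × ℂ → X` -/

section ProdChart

variable {X : Type*}

/-- **The product charts of `ℂℙ¹ × ℂ` through `ι`**: `prodChart i ι (z, t) = ι (linePt i z, t)`,
the map `ι : ℂℙ¹ × ℂ → X` (e.g. a product neighbourhood of an embedded sphere with trivial normal
bundle) read in the affine chart `i` of the sphere factor (the charts in which maps near the
sphere are written in Wendl (2018), proofs of Thm. 2.46 / Prop. 2.53). [folklore] -/
def prodChart (i : Fin 2) (ι : ComplexProjectiveSpace 1 × ℂ → X) : ℂ × ℂ → X :=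
  fun q => ι (linePt i q.1, q.2)

variable {ι : ComplexProjectiveSpace 1 × ℂ → X}

/-- Values of `prodChart`. [folklore] -/
theorem prodChart_apply (i : Fin 2) (ι : ComplexProjectiveSpace 1 × ℂ → X) (q : ℂ × ℂ) :
    prodChart i ι q = ι (linePt i q.1, q.2) := rfl

/-- `prodChart i ι = ι ∘ (linePt i × id)`. [folklore] -/
theorem prodChart_eq_comp (i : Fin 2) (ι : ComplexProjectiveSpace 1 × ℂ → X) :
    prodChart i ι = ι ∘ fun q : ℂ × ℂ => (linePt i q.1, q.2) := rfl

/-- **The two product charts differ by the inversion of the sphere coordinate**: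
`prodChart 1 ι (w, t) = prodChart 0 ι (w⁻¹, t)` for `w ≠ 0`. [folklore] -/
theorem prodChart_one_eq (ι : ComplexProjectiveSpace 1 × ℂ → X) {q : ℂ × ℂ} (hq : q.1 ≠ 0) :
    prodChart 1 ι q = prodChart 0 ι (q.1⁻¹, q.2) := by
  rw [prodChart_apply, prodChart_apply, linePt_one_eq_linePt_zero_inv hq]

/-- Symmetrically, `prodChart 0 ι (z, t) = prodChart 1 ι (z⁻¹, t)` for `z ≠ 0`. [folklore] -/
theorem prodChart_zero_eq (ι : ComplexProjectiveSpace 1 × ℂ → X) {q : ℂ × ℂ} (hq : q.1 ≠ 0) :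
    prodChart 0 ι q = prodChart 1 ι (q.1⁻¹, q.2) := by
  rw [prodChart_apply, prodChart_apply, linePt_zero_eq_linePt_one_inv hq]

/-- The map `(w, t) ↦ (w⁻¹, t)` exchanging the two product charts. [folklore] -/
theorem prodChart_one_eq_comp_on (ι : ComplexProjectiveSpace 1 × ℂ → X) :
    EqOn (prodChart 1 ι) (prodChart 0 ι ∘ fun q : ℂ × ℂ => (q.1⁻¹, q.2)) {q | q.1 ≠ 0} :=
  fun _ hq => prodChart_one_eq ι hq

/-- Near a point with `w ≠ 0`, `prodChart 1 ι` is `prodChart 0 ι` composed with `(w, t) ↦ (w⁻¹, t)`.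
[folklore] -/
theorem prodChart_one_eventuallyEq (ι : ComplexProjectiveSpace 1 × ℂ → X) {q : ℂ × ℂ}
    (hq : q.1 ≠ 0) :
    prodChart 1 ι =ᶠ[𝓝 q] (prodChart 0 ι ∘ fun q : ℂ × ℂ => (q.1⁻¹, q.2)) :=
  eventuallyEq_of_mem ((isOpen_ne.preimage continuous_fst).mem_nhds hq)
    (prodChart_one_eq_comp_on ι)

/-- Near a point with `z ≠ 0`, `prodChart 0 ι` is `prodChart 1 ι` composed with `(z, t) ↦ (z⁻¹, t)`.
[folklore] -/
theorem prodChart_zero_eventuallyEq (ι : ComplexProjectiveSpace 1 × ℂ → X) {q : ℂ × ℂ}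
    (hq : q.1 ≠ 0) :
    prodChart 0 ι =ᶠ[𝓝 q] (prodChart 1 ι ∘ fun q : ℂ × ℂ => (q.1⁻¹, q.2)) :=
  eventuallyEq_of_mem ((isOpen_ne.preimage continuous_fst).mem_nhds hq)
    fun _ hq' => prodChart_zero_eq ι hq'

/-- **Along `t = 0` the product chart `i` is the chart `i` of the central sphere**: if
`ι (θ, 0) = F₀ θ` and `F₀ = w ∘ (affineCoordComplex i · 0)` on `{pᵢ ≠ 0}`, then
`prodChart i ι (z, 0) = w z`. [folklore] -/
theorem prodChart_apply_zero_eq {F₀ : ComplexProjectiveSpace 1 → X} {i : Fin 2} {w : ℂ → X}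
    (hF₀ : ∀ p, CoordNeZero i p → F₀ p = w (affineCoordComplex i p 0))
    (hι : ∀ θ, ι (θ, 0) = F₀ θ) (z : ℂ) : prodChart i ι (z, 0) = w z := by
  rw [prodChart_apply, hι, apply_linePt_eq hF₀]

/-- `prodChart 0 ι (z, 0) = u₀ z` for the two-chart sphere `(u₀, v₀)` glued to `F₀ = ι (·, 0)`.
[folklore] -/
theorem prodChart_zero_zero_eq {F₀ : ComplexProjectiveSpace 1 → X} {u₀ : ℂ → X}
    (hF₀ : ∀ p, CoordNeZero 0 p → F₀ p = u₀ (affineCoordComplex 0 p 0))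
    (hι : ∀ θ, ι (θ, 0) = F₀ θ) (z : ℂ) : prodChart 0 ι (z, 0) = u₀ z :=
  prodChart_apply_zero_eq hF₀ hι z

/-- `prodChart 1 ι (w, 0) = v₀ w` for the two-chart sphere `(u₀, v₀)` glued to `F₀ = ι (·, 0)`.
[folklore] -/
theorem prodChart_one_zero_eq {F₀ : ComplexProjectiveSpace 1 → X} {v₀ : ℂ → X}
    (hF₀ : ∀ p, CoordNeZero 1 p → F₀ p = v₀ (affineCoordComplex 1 p 0))
    (hι : ∀ θ, ι (θ, 0) = F₀ θ) (w : ℂ) : prodChart 1 ι (w, 0) = v₀ w :=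
  prodChart_apply_zero_eq hF₀ hι w

/-- `prodChart i ι` is injective when `ι` is. [folklore] -/
theorem prodChart_injective (i : Fin 2) (hι : Injective ι) : Injective (prodChart i ι) := by
  intro q q' h
  obtain ⟨h1, h2⟩ := Prod.mk.inj (hι h)
  exact Prod.ext (linePt_injective i h1) h2

/-- The image of `prodChart i ι` is `ι ({pᵢ ≠ 0} × ℂ)`. [folklore] -/
theorem range_prodChart (i : Fin 2) (ι : ComplexProjectiveSpace 1 × ℂ → X) :
    range (prodChart i ι) = ι '' ({p | CoordNeZero i p} ×ˢ univ) := by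
  ext x
  constructor
  · rintro ⟨q, rfl⟩
    exact ⟨(linePt i q.1, q.2), ⟨coordNeZero_linePt i q.1, mem_univ _⟩, rfl⟩
  · rintro ⟨⟨p, t⟩, ⟨hp, -⟩, rfl⟩
    refine ⟨(affineCoordComplex i p 0, t), ?_⟩
    show ι (linePt i (affineCoordComplex i p 0), t) = ι (p, t)
    rw [linePt_affineCoordComplex hp]

/-- The two product charts cover the image of `ι`. [folklore] -/
theorem range_prodChart_zero_union (ι : ComplexProjectiveSpace 1 × ℂ → X) :
    range (prodChart 0 ι) ∪ range (prodChart 1 ι) = range ι := by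
  apply Subset.antisymm
  · rintro x (⟨q, rfl⟩ | ⟨q, rfl⟩) <;> exact ⟨_, rfl⟩
  · rintro x ⟨⟨p, t⟩, rfl⟩
    rcases eq_linePt_zero_or_eq_linePt_one_zero p with ⟨z, rfl⟩ | rfl
    · exact Or.inl ⟨(z, t), rfl⟩
    · exact Or.inr ⟨(0, t), rfl⟩

variable [TopologicalSpace X]

/-- `prodChart i ι` is continuous when `ι` is. [folklore] -/
theorem continuous_prodChart (i : Fin 2) (hι : Continuous ι) : Continuous (prodChart i ι) :=
  hι.comp (((continuous_linePt i).comp continuous_fst).prodMk continuous_snd)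

/-- The map `(z, t) ↦ (linePt i z, t)` is `C^m` (every `m`) from `(ℂ × ℂ, 𝓘(ℝ, ℂ × ℂ))` to
`(ℂℙ¹ × ℂ, (𝓡 2).prod 𝓘(ℝ, ℂ))`. [folklore] -/
theorem contMDiff_linePt_prod (i : Fin 2) {m : WithTop ℕ∞} :
    ContMDiff 𝓘(ℝ, ℂ × ℂ) ((𝓡 2).prod 𝓘(ℝ, ℂ)) m
      (fun q : ℂ × ℂ => (linePt i q.1, q.2)) :=
  ((contMDiff_linePt' i).comp contDiff_fst.contMDiff).prodMk contDiff_snd.contMDiff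

/-- The map `(z, t) ↦ (linePt i z, t)` is an open embedding. [folklore] -/
theorem isOpenEmbedding_linePt_prod (i : Fin 2) :
    Topology.IsOpenEmbedding (fun q : ℂ × ℂ => (linePt i q.1, q.2)) :=
  (isOpenEmbedding_linePt i).prodMap Topology.IsOpenEmbedding.id

/-- `prodChart i ι` is an open embedding when `ι` is; in particular its image is open. [folklore] -/
theorem isOpenEmbedding_prodChart (i : Fin 2) (hι : Topology.IsOpenEmbedding ι) :
    Topology.IsOpenEmbedding (prodChart i ι) :=
  hι.comp (isOpenEmbedding_linePt_prod i)

/-- **Differential of `(z, t) ↦ (linePt i z, t)`**: `(a, b) ↦ (d(linePt i)_z a, b)`. [folklore] -/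
theorem hasMFDerivAt_linePt_prod (i : Fin 2) (q : ℂ × ℂ) :
    HasMFDerivAt 𝓘(ℝ, ℂ × ℂ) ((𝓡 2).prod 𝓘(ℝ, ℂ)) (fun q : ℂ × ℂ => (linePt i q.1, q.2)) q
      (((mfderiv 𝓘(ℝ, ℂ) (𝓡 2) (linePt i) q.1).comp (ContinuousLinearMap.fst ℝ ℂ ℂ)).prod
        (ContinuousLinearMap.snd ℝ ℂ ℂ)) := by
  have h0 : HasMFDerivAt 𝓘(ℝ, ℂ × ℂ) 𝓘(ℝ, ℂ) (Prod.fst : ℂ × ℂ → ℂ) q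
      (ContinuousLinearMap.fst ℝ ℂ ℂ) :=
    (ContinuousLinearMap.fst ℝ ℂ ℂ).hasMFDerivAt
  have h1 : HasMFDerivAt 𝓘(ℝ, ℂ × ℂ) (𝓡 2) (fun q : ℂ × ℂ => linePt i q.1) q
      ((mfderiv 𝓘(ℝ, ℂ) (𝓡 2) (linePt i) q.1).comp (ContinuousLinearMap.fst ℝ ℂ ℂ)) :=
    (mdifferentiable_linePt i q.1).hasMFDerivAt.comp q h0
  have h2 : HasMFDerivAt 𝓘(ℝ, ℂ × ℂ) 𝓘(ℝ, ℂ) (Prod.snd : ℂ × ℂ → ℂ) q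
      (ContinuousLinearMap.snd ℝ ℂ ℂ) :=
    (ContinuousLinearMap.snd ℝ ℂ ℂ).hasMFDerivAt
  exact h1.prodMk h2

/-- The differential of `(z, t) ↦ (linePt i z, t)` is injective. [folklore] -/
theorem injective_mfderiv_linePt_prod (i : Fin 2) (q : ℂ × ℂ) :
    Injective (mfderiv 𝓘(ℝ, ℂ × ℂ) ((𝓡 2).prod 𝓘(ℝ, ℂ))
      (fun q : ℂ × ℂ => (linePt i q.1, q.2)) q) := by
  rw [(hasMFDerivAt_linePt_prod i q).mfderiv]
  intro v v' h
  have h1 : mfderiv 𝓘(ℝ, ℂ) (𝓡 2) (linePt i) q.1 v.1 = mfderiv 𝓘(ℝ, ℂ) (𝓡 2) (linePt i) q.1 v'.1 :=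
    congrArg Prod.fst h
  have h2 := congrArg Prod.snd h
  exact Prod.ext (injective_mfderiv_linePt i q.1 h1) h2

variable [ChartedSpace (EuclideanSpace ℝ (Fin 4)) X]

/-- **The product charts are `C^m`** when `ι` is `C^m` from `(ℂℙ¹ × ℂ, (𝓡 2).prod 𝓘(ℝ, ℂ))`.
[folklore] -/
theorem contMDiff_prodChart (i : Fin 2) {m : WithTop ℕ∞}
    (hι : ContMDiff ((𝓡 2).prod 𝓘(ℝ, ℂ)) (𝓡 4) m ι) :
    ContMDiff 𝓘(ℝ, ℂ × ℂ) (𝓡 4) m (prodChart i ι) :=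
  hι.comp (contMDiff_linePt_prod i)

/-- `prodChart i ι` is `C^∞` on an open set as soon as `ι` is `C^∞` on its image. [folklore] -/
theorem contMDiffOn_prodChart (i : Fin 2) {m : WithTop ℕ∞} {s : Set (ComplexProjectiveSpace 1 × ℂ)}
    (hι : ContMDiffOn ((𝓡 2).prod 𝓘(ℝ, ℂ)) (𝓡 4) m ι s) :
    ContMDiffOn 𝓘(ℝ, ℂ × ℂ) (𝓡 4) m (prodChart i ι)
      ((fun q : ℂ × ℂ => (linePt i q.1, q.2)) ⁻¹' s) :=
  hι.comp (contMDiff_linePt_prod i).contMDiffOn fun _ hq => hq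

/-- **Chain rule for the product charts**: `d(prodChart i ι)_q = dι ∘ (d(linePt i) × id)`.
[folklore] -/
theorem hasMFDerivAt_prodChart (i : Fin 2) {q : ℂ × ℂ}
    (hι : MDifferentiableAt ((𝓡 2).prod 𝓘(ℝ, ℂ)) (𝓡 4) ι (linePt i q.1, q.2)) :
    HasMFDerivAt 𝓘(ℝ, ℂ × ℂ) (𝓡 4) (prodChart i ι) q
      ((mfderiv ((𝓡 2).prod 𝓘(ℝ, ℂ)) (𝓡 4) ι (linePt i q.1, q.2)).comp
        (((mfderiv 𝓘(ℝ, ℂ) (𝓡 2) (linePt i) q.1).comp (ContinuousLinearMap.fst ℝ ℂ ℂ)).prod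
          (ContinuousLinearMap.snd ℝ ℂ ℂ))) :=
  hι.hasMFDerivAt.comp q (hasMFDerivAt_linePt_prod i q)

/-- The differential of a product chart, as a composition. [folklore] -/
theorem mfderiv_prodChart (i : Fin 2) {q : ℂ × ℂ}
    (hι : MDifferentiableAt ((𝓡 2).prod 𝓘(ℝ, ℂ)) (𝓡 4) ι (linePt i q.1, q.2)) :
    mfderiv 𝓘(ℝ, ℂ × ℂ) (𝓡 4) (prodChart i ι) q =
      (mfderiv ((𝓡 2).prod 𝓘(ℝ, ℂ)) (𝓡 4) ι (linePt i q.1, q.2)).comp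
        (((mfderiv 𝓘(ℝ, ℂ) (𝓡 2) (linePt i) q.1).comp (ContinuousLinearMap.fst ℝ ℂ ℂ)).prod
          (ContinuousLinearMap.snd ℝ ℂ ℂ)) :=
  (hasMFDerivAt_prodChart i hι).mfderiv

/-- **The product charts are immersions when `ι` is**: if `ι` is differentiable with injective
differential at `(linePt i z, t)`, then `d(prodChart i ι)_{(z, t)}` is injective. [folklore] -/
theorem injective_mfderiv_prodChart_of_mdifferentiableAt (i : Fin 2) {q : ℂ × ℂ}
    (hι : MDifferentiableAt ((𝓡 2).prod 𝓘(ℝ, ℂ)) (𝓡 4) ι (linePt i q.1, q.2))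
    (hιimm : Injective (mfderiv ((𝓡 2).prod 𝓘(ℝ, ℂ)) (𝓡 4) ι (linePt i q.1, q.2))) :
    Injective (mfderiv 𝓘(ℝ, ℂ × ℂ) (𝓡 4) (prodChart i ι) q) := by
  rw [mfderiv_prodChart i hι]
  exact hιimm.comp (by
    have h := injective_mfderiv_linePt_prod i q
    rwa [(hasMFDerivAt_linePt_prod i q).mfderiv] at h)

/-- **The product charts of a `C^∞` immersion `ι : ℂℙ¹ × ℂ → X` are `C^∞` immersions
`ℂ × ℂ → X`.** [folklore] -/
theorem injective_mfderiv_prodChart (i : Fin 2) (hι : ContMDiff ((𝓡 2).prod 𝓘(ℝ, ℂ)) (𝓡 4) ∞ ι)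
    (hιimm : ∀ q, Injective (mfderiv ((𝓡 2).prod 𝓘(ℝ, ℂ)) (𝓡 4) ι q)) (q : ℂ × ℂ) :
    Injective (mfderiv 𝓘(ℝ, ℂ × ℂ) (𝓡 4) (prodChart i ι) q) :=
  injective_mfderiv_prodChart_of_mdifferentiableAt i ((hι _).mdifferentiableAt (by simp)) (hιimm _)

/-! ### Derivatives along the central sphere and across the chart change -/

/-- **Derivative along a slice `t = const`**: `z ↦ prodChart i ι (z, t)` has differential
`d(prodChart i ι)_{(z, t)} ∘ inl`. [folklore] -/
theorem hasMFDerivAt_prodChart_slice (i : Fin 2) {z t : ℂ}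
    (h : MDifferentiableAt 𝓘(ℝ, ℂ × ℂ) (𝓡 4) (prodChart i ι) (z, t)) :
    HasMFDerivAt 𝓘(ℝ, ℂ) (𝓡 4) (fun z : ℂ => prodChart i ι (z, t)) z
      ((mfderiv 𝓘(ℝ, ℂ × ℂ) (𝓡 4) (prodChart i ι) (z, t)).comp (ContinuousLinearMap.inl ℝ ℂ ℂ)) := by
  have h1 : HasMFDerivAt 𝓘(ℝ, ℂ) 𝓘(ℝ, ℂ × ℂ) (fun z : ℂ => (z, t)) z
      (ContinuousLinearMap.inl ℝ ℂ ℂ) :=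
    ((hasFDerivAt_id z).prodMk (hasFDerivAt_const t z)).hasMFDerivAt
  show HasMFDerivAt 𝓘(ℝ, ℂ) (𝓡 4) (prodChart i ι ∘ fun z : ℂ => (z, t)) z _
  exact h.hasMFDerivAt.comp z h1

/-- **The differential of the central sphere's chart from the product chart**: if
`prodChart i ι (z, t) = w z` for all `z` (e.g. `t = 0`, `w = u₀`, `prodChart_zero_zero_eq`), then
`dw_z = d(prodChart i ι)_{(z, t)} ∘ inl`. [folklore] -/
theorem mfderiv_prodChart_comp_inl (i : Fin 2) {t : ℂ} {w : ℂ → X}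
    (hw : ∀ z, prodChart i ι (z, t) = w z) {z : ℂ}
    (h : MDifferentiableAt 𝓘(ℝ, ℂ × ℂ) (𝓡 4) (prodChart i ι) (z, t)) :
    (mfderiv 𝓘(ℝ, ℂ × ℂ) (𝓡 4) (prodChart i ι) (z, t)).comp (ContinuousLinearMap.inl ℝ ℂ ℂ) =
      mfderiv 𝓘(ℝ, ℂ) (𝓡 4) w z := by
  have h1 := hasMFDerivAt_prodChart_slice i h
  rw [show (fun z : ℂ => prodChart i ι (z, t)) = w from funext hw] at h1
  exact h1.mfderiv.symm

/-- **Chain rule across the chart change**: near a point with `w ≠ 0`,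
`prodChart 1 ι = prodChart 0 ι ∘ Ψ`, so `d(prodChart 1 ι)_q = d(prodChart 0 ι)_{Ψ q} ∘ dΨ_q`.
[folklore] -/
theorem hasMFDerivAt_prodChart_one_of_ne {q : ℂ × ℂ} (hq : q.1 ≠ 0)
    (hι : MDifferentiableAt 𝓘(ℝ, ℂ × ℂ) (𝓡 4) (prodChart 0 ι) (q.1⁻¹, q.2)) :
    HasMFDerivAt 𝓘(ℝ, ℂ × ℂ) (𝓡 4) (prodChart 1 ι) q
      ((mfderiv 𝓘(ℝ, ℂ × ℂ) (𝓡 4) (prodChart 0 ι) (q.1⁻¹, q.2)).comp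
        (fderiv ℝ (fun q : ℂ × ℂ => (q.1⁻¹, q.2)) q)) :=
  (hι.hasMFDerivAt.comp q (differentiableAt_invFst hq).hasFDerivAt.hasMFDerivAt).congr_of_eventuallyEq
    (prodChart_one_eventuallyEq ι hq)

/-- Symmetrically, `d(prodChart 0 ι)_q = d(prodChart 1 ι)_{Ψ q} ∘ dΨ_q` near a point with `z ≠ 0`.
[folklore] -/
theorem hasMFDerivAt_prodChart_zero_of_ne {q : ℂ × ℂ} (hq : q.1 ≠ 0)
    (hι : MDifferentiableAt 𝓘(ℝ, ℂ × ℂ) (𝓡 4) (prodChart 1 ι) (q.1⁻¹, q.2)) :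
    HasMFDerivAt 𝓘(ℝ, ℂ × ℂ) (𝓡 4) (prodChart 0 ι) q
      ((mfderiv 𝓘(ℝ, ℂ × ℂ) (𝓡 4) (prodChart 1 ι) (q.1⁻¹, q.2)).comp
        (fderiv ℝ (fun q : ℂ × ℂ => (q.1⁻¹, q.2)) q)) :=
  (hι.hasMFDerivAt.comp q (differentiableAt_invFst hq).hasFDerivAt.hasMFDerivAt).congr_of_eventuallyEq
    (prodChart_zero_eventuallyEq ι hq)

/-- The chain rule across the chart change, applied to a vector:
`d(prodChart 1 ι)_{(w, t)} (a, b) = d(prodChart 0 ι)_{(w⁻¹, t)} (-w⁻² a, b)`. [folklore] -/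
theorem mfderiv_prodChart_one_apply_of_ne {q : ℂ × ℂ} (hq : q.1 ≠ 0)
    (hι : MDifferentiableAt 𝓘(ℝ, ℂ × ℂ) (𝓡 4) (prodChart 0 ι) (q.1⁻¹, q.2)) (v : ℂ × ℂ) :
    mfderiv 𝓘(ℝ, ℂ × ℂ) (𝓡 4) (prodChart 1 ι) q v =
      mfderiv 𝓘(ℝ, ℂ × ℂ) (𝓡 4) (prodChart 0 ι) (q.1⁻¹, q.2) (-(q.1 ^ 2)⁻¹ * v.1, v.2) := by
  rw [(hasMFDerivAt_prodChart_one_of_ne hq hι).mfderiv, ← fderiv_invFst_apply hq v]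
  rfl

end ProdChart

end Literature.Geometry.Symplectic

end
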